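import Mathlib
import Summits.CriticalPhenomena.PercolationContinuityZ3.Theorems.PercNearOneGluingNoHeavyLowerTailPocketSizeGluing
import HarnessLib

/-!
# Crux `PercNearOneGluing.NoHeavyLowerTail` (stmt-CriticalPhenomena-4575), line `bhk-superadditivity-thinning` —
# POCKET-SIZE GLUING, vertex form and the `NearOneGluing` corollary

Lead prover-line-stmt-CriticalPhenomena-4575-c5-0, 2026-08-16.  Proves the registered stubs `pocketSizeGluing`
(the observer-vertex case `O = {o}` of `pocketSizeGluing_block`, companion file
`…NoHeavyLowerTailPocketSizeGluing.lean`) and `nearOneGluing_of_pocketSize`: Kozma–Nitzan's Conjecture 3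
(arXiv:2401.12397 p. 15) ≡ `NearOneGluing` ≡ this crux holds on the class of observers whose relay-free
region has at most `m` vertices, with the explicit `δ = (ε/2)^(m+1)`, uniformly in `|A|` and `n`.
See the companion file for the theorem, the proof and the discussion.  No new definitions.
-/

namespace Summit.CriticalPhenomena.PercolationContinuityZ3.Theorems

open MeasureTheory Set
open Literature.Probability.LatticeModels (prodBernoulli)
open Literature.Probability.Percolation (BondConfig openConn)

noncomputable section
open Classical

variable {n : ℕ}

/-- **Pocket-size gluing** (registered stub `pocketSizeGluing` of crux stmt-CriticalPhenomena-4575, line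
`bhk-superadditivity-thinning`).  Finite weighted graph on `Fin n`, relay set `A ∋ b`, observer `o ∉ A`,
and a vertex set `F ∌ o` disjoint from `A` such that every positive-weight pair with an endpoint in
`{o} ∪ F` has its other endpoint in `{o} ∪ F ∪ A` (e.g. `F` = the `A`-free component of `o`).  If
`μ(a ↮ b) ≤ t` for all `a ∈ A` then `(μ(o ↔ A) − μ(o ↔ b)) ^ (|F| + 1) ≤ t`, and for `F ≠ ∅`
`(μ(o ↔ A) − μ(o ↔ b)) ^ |F| · μ(o ↮ b) ≤ t`.  (Kozma–Nitzan Thm 4 is `F = ∅`; for `|F| ≥ 2` with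
branching this is new.)  The case `O = {o}` of `pocketSizeGluing_block` (`glue w {o} = w`). -/
theorem pocketSizeGluing : ∀ (n : ℕ) (w : Sym2 (Fin n) → unitInterval) (F A : Finset (Fin n)) (o b : Fin n) (t : ℝ), b ∈ A → o ∉ A → o ∉ F → Disjoint F A → (∀ x ∈ insert o F, ∀ y : Fin n, y ≠ o → y ∉ F → y ∉ A → w s(x, y) = 0) → (∀ a ∈ A, (Literature.Probability.LatticeModels.prodBernoulli w).real (Literature.Probability.Percolation.openConn a b)ᶜ ≤ t) → ((Literature.Probability.LatticeModels.prodBernoulli w).real (⋃ a ∈ A, Literature.Probability.Percolation.openConn o a) - (Literature.Probability.LatticeModels.prodBernoulli w).real (Literature.Probability.Percolation.openConn o b)) ^ (F.card + 1) ≤ t ∧ (F.Nonempty → ((Literature.Probability.LatticeModels.prodBernoulli w).real (⋃ a ∈ A, Literature.Probability.Percolation.openConn o a) - (Literature.Probability.LatticeModels.prodBernoulli w).real (Literature.Probability.Percolation.openConn o b)) ^ F.card * (Literature.Probability.LatticeModels.prodBernoulli w).real (Literature.Probability.Percolation.openConn o b)ᶜ ≤ t) := by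
  intro n w F A o b t hbA hoA hoF hFA hcl hrel
  have hOA : Disjoint ({o} : Finset (Fin n)) A := Finset.disjoint_singleton_left.2 hoA
  have hOF : Disjoint ({o} : Finset (Fin n)) F := Finset.disjoint_singleton_left.2 hoF
  have hcl' : ∀ x ∈ ({o} : Finset (Fin n)) ∪ F, ∀ y : Fin n,
      y ∉ ({o} : Finset (Fin n)) → y ∉ F → y ∉ A → w s(x, y) = 0 := by
    intro x hx y hyo hyF hyA
    rw [← Finset.insert_eq] at hx
    exact hcl x hx y (fun h => hyo (Finset.mem_singleton.2 h)) hyF hyA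
  have key := pocketSizeGluing_block n w {o} F A b t hbA hOA hFA hOF hcl'
  rw [agPartial_glue_singleton, Finset.set_biUnion_singleton, Finset.set_biUnion_singleton] at key
  have hset : {ω : BondConfig (Fin n) | ∀ o' ∈ ({o} : Finset (Fin n)), ω ∉ openConn o' b} =
      (openConn o b)ᶜ := by
    ext ω
    simp only [Finset.mem_singleton, forall_eq, Set.mem_setOf_eq, Set.mem_compl_iff]
  rw [hset] at key
  exact key hrel

/-- **`NearOneGluing` (Kozma–Nitzan Conjecture 3 ≡ this crux) on the class of observers with a relay-free
region of at most `m` vertices, with the explicit rate `δ = (ε/2)^(m+1)`** (registered stub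
`nearOneGluing_of_pocketSize` of crux stmt-CriticalPhenomena-4575, line `bhk-superadditivity-thinning`).
For every `m` and `ε > 0`: on every finite weighted graph, if `b ∈ A`, `o ∉ A`, `F ∌ o` is disjoint from
`A`, has at most `m` vertices and every positive-weight pair leaving `{o} ∪ F` ends in `{o} ∪ F ∪ A`, then
`μ(o ↔ A) > 1 − (ε/2)^(m+1)` and `μ(a ↔ b) > 1 − (ε/2)^(m+1)` for all `a ∈ A` imply `μ(o ↔ b) > 1 − ε` —
uniformly in `|A|` and `n`.  From `pocketSizeGluing`: `bad ^ (|F|+1) < (ε/2)^(m+1)` forces `bad < ε/2`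
when `ε ≤ 1`, and `μ(o ↮ b) = μ(o ↮ A) + bad`. -/
theorem nearOneGluing_of_pocketSize : ∀ (m : ℕ) (ε : ℝ), 0 < ε → ∀ (n : ℕ) (w : Sym2 (Fin n) → unitInterval) (F A : Finset (Fin n)) (o b : Fin n), b ∈ A → o ∉ A → o ∉ F → Disjoint F A → F.card ≤ m → (∀ x ∈ insert o F, ∀ y : Fin n, y ≠ o → y ∉ F → y ∉ A → w s(x, y) = 0) → 1 - (ε / 2) ^ (m + 1) < (Literature.Probability.LatticeModels.prodBernoulli w).real (⋃ a ∈ A, Literature.Probability.Percolation.openConn o a) → (∀ a ∈ A, 1 - (ε / 2) ^ (m + 1) < (Literature.Probability.LatticeModels.prodBernoulli w).real (Literature.Probability.Percolation.openConn a b)) → 1 - ε < (Literature.Probability.LatticeModels.prodBernoulli w).real (Literature.Probability.Percolation.openConn o b) := by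
  intro m ε hε n w F A o b hbA hoA hoF hFA hFm hcl hA hrel
  set P := prodBernoulli w with hP
  by_cases hε1 : 1 < ε
  · exact lt_of_lt_of_le (by linarith) measureReal_nonneg
  push Not at hε1
  have hq0 : 0 ≤ ε / 2 := by linarith
  have hq1 : ε / 2 ≤ 1 := by linarith
  -- the worst relay unreliability `t₀ < δ`
  obtain ⟨aM, haM, hmax⟩ := Finset.exists_max_image A (fun a => P.real (openConn a b)ᶜ) ⟨b, hbA⟩
  set t₀ : ℝ := P.real (openConn aM b)ᶜ with ht₀
  have ht₀δ : t₀ < (ε / 2) ^ (m + 1) := by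
    have h := hrel aM haM
    rw [ht₀, probReal_compl_eq_one_sub (pocketGlue_measurableSet _)]
    linarith
  obtain ⟨hweak, -⟩ := pocketSizeGluing n w F A o b t₀ hbA hoA hoF hFA hcl hmax
  -- `bad < ε / 2`
  set bad : ℝ := P.real (⋃ a ∈ A, openConn o a) - P.real (openConn o b) with hbad
  have hbad_lt : bad < ε / 2 := by
    by_contra hge
    push Not at hge
    have h1 : (ε / 2) ^ (m + 1) ≤ (ε / 2) ^ (F.card + 1) :=
      pow_le_pow_of_le_one hq0 hq1 (by omega)
    have h2 : (ε / 2) ^ (F.card + 1) ≤ bad ^ (F.card + 1) := pow_le_pow_left₀ hq0 hge _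
    linarith
  have hδε : (ε / 2) ^ (m + 1) ≤ ε / 2 := pow_le_of_le_one hq0 hq1 (Nat.succ_ne_zero m)
  have : P.real (openConn o b) = P.real (⋃ a ∈ A, openConn o a) - bad := by rw [hbad]; ring
  rw [this]
  linarith

end

end Summit.CriticalPhenomena.PercolationContinuityZ3.Theorems
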